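import Literature.NumberTheory.Automorphic.ReciprocityGLnRestrictionProofs
import Literature.NumberTheory.Automorphic.IsAutomorphicAE
import Literature.NumberTheory.Automorphic.AdeleBaseChange
import HarnessLib

/-!
# The Satake family of an `ℓ`-adic Galois representation of a number field

Topic `Literature/NumberTheory/GaloisRepresentations` (definition request
`defn-satakeFamilyOfFramedGaloisRep` of route `MaassFreeConverse`, summit `Langlands`).  Let `K` be a
number field, `ℓ` a prime, `ι : ℚ̄_ℓ ≃+* ℂ` (`ℚ̄_ℓ = PadicAlgCl ℓ`, an explicit datum),
`ρ : Γ_K →ₜ* GL_n(ℚ̄_ℓ)` a framed continuous Galois representation (accepted `FramedGaloisRep`, with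
`IsUnramifiedAt` and `HasFrobCharpolyAt v P`: every *arithmetic* Frobenius at every prime above `v`
has characteristic polynomial `P`) and `e : ℕ` a normalisation shift.  The accepted dictionary
`arithFrobPolyOfSatake ι q e α = ∏_{a ∈ α} (X - ι⁻¹((q^{(e-1)/2} a)⁻¹))` (`Automorphic/ReciprocityGLn`)
is the characteristic polynomial of arithmetic Frobenius *predicted* by a Satake parameter `α` of
an unramified `π_v` on `GL_n` (`e = n`: the unitary normalisation of Harris–Lan–Taylor–Thorne,
Thm. A, `ρ|_{W_v}^{ss} = ι⁻¹ rec(π_v ⊗ |det|^{(1-n)/2})`, used by **lang.S27** and by the route;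
`e = 1`: Buzzard–Gee's L-normalisation, **lang.S03** / `IsAutomorphicAE`).  This file inverts it:

* `satakeParamOfFrobEigenvalue ι q e r = q^{-(e-1)/2} · ι(r)⁻¹`, the Satake entry attached to an
  eigenvalue `r ∈ ℚ̄_ℓ` of arithmetic Frobenius; `arithFrobPolyOfSatake ι q e` and
  `Multiset.map (satakeParamOfFrobEigenvalue ι q e)` (on roots) are mutually inverse, so the
  dictionary is injective (`arithFrobPolyOfSatake_injective`, any shift).
* `satakeFamilyOfFramedGaloisRep ι e ρ : HeightOneSpectrum (𝓞 K) → Multiset ℂ` (an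
  `Automorphic.SatakeFamily K` when `K : Type`) — **the Satake family of `ρ`**: at a finite place
  `v`, *the* multiset `α` with `ρ.HasFrobCharpolyAt v (arithFrobPolyOfSatake ι q_v e α)` if there
  is one (it is unique, `satakeFamilyOfFramedGaloisRep_eq_of_hasFrobCharpolyAt`), and the
  documented **junk value `{1, …, 1}` (`n` entries)** otherwise.  Wherever `ρ` is unramified such
  an `α` exists, namely `{q_v^{-(e-1)/2} ι(r)⁻¹ : r}` over the eigenvalues `r` (with multiplicity)
  of `ρ(Frob_v)` (`IsUnramifiedAt.satakeFamilyOfFramedGaloisRep_eq`,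
  `IsUnramifiedAt.hasFrobCharpolyAt_satakeFamilyOfFramedGaloisRep`): for `ρ` unramified almost
  everywhere this is the almost-everywhere-defined Satake family of the literature ("the
  `ι`-eigenvalues of `ρ(Frob_v)` at the unramified `v`", Buzzard–Gee 2014, §2.2, Conj. 3.2.1,
  Rem. 3.2.5; Harris–Lan–Taylor–Thorne 2016, Thm. A for the half-twist `q^{(n-1)/2}`).
* API: `card_…` / `…_ne_zero` (`n` non-zero entries at *every* place — the route's item asks
  `∀ v, card (α v) = m + 1`), `eventually_hasFrobCharpolyAt_…` (unramified a.e. ⟹ compatible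
  a.e.), `eventuallyEq_…` (uniqueness off a finite set), `…_conj` / `…_congr_equiv` (change of
  frame / isomorphism), `…_restrictField` (`α_w = α_v^{f(w|v)}` under restriction to `Γ_L`,
  pointwise and a.e.), and the bridge to automorphic partners:
  `exists_hasSatakeParamAt_and_hasFrobCharpolyAt_iff` (the existential per-place clause of
  **lang.S27** / **lang.S03** / the route ⟺ `π.HasSatakeParamAt v (satakeFamily… v) ∧ unramified`),
  `satakeFrobCompatibleAE_iff_satakeFamilyOfFramedGaloisRep`,
  `satakeFamilyOfFramedGaloisRep_eq_of_isGaloisCompatibleAt`.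

## Design notes / what is NOT here

* Uniqueness / existence of the framed Frobenius polynomial at unramified places are the accepted
  `FramedGaloisRep.HasFrobCharpolyAt.unique`, `FramedGaloisRep.IsUnramifiedAt.hasFrobCharpolyAt_charpoly`
  of `ResidualPairIntegrality` (landed concurrently); used here through `private` local copies so
  that this file does not import the residual-representation cone.
* The value is chosen through `HasFrobCharpolyAt` (not `GaloisRep.frobCharpoly`), so it is
  meaningful at a ramified place too whenever all Frobenius lifts share one characteristic
  polynomial.  `e = 0` behaves like `e = 1` (`ℕ`-subtraction in `arithFrobPolyOfSatake`).
* Twists and duals (`α(ρ ⊗ χ) = α(ρ)α(χ)`, `α(ρ^∨)_v = q_v^{-(e-1)} α(ρ)_v⁻¹`) need rank-`n`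
  Frobenius lemmas for `FramedRep.twist` / `FramedRep.dual` that the tree has only in rank `2`
  (`FramedGaloisRep.hasFrobCharpolyAt_dual_fin_two`); left to a sequel.
* Mathlib has no Satake parameters and no automorphic Galois representations
  (`lean search 'satake'`: only this tree's `Literature.NumberTheory.Automorphic`).

## References

* K. Buzzard, T. Gee, *The conjectural connections between automorphic representations and
  Galois representations*, LMS LNS 414 (2014), §2.2 (Satake parameters), Conj. 3.2.1,
  Rem. 3.2.5 (numbering of arXiv:1009.0785). [BuzzardGeeLMS2014]
* M. Harris, K.-W. Lan, R. Taylor, J. Thorne, *On the rigid cohomology of certain Shimura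
  varieties*, Res. Math. Sci. 3 (2016), Thm. A. [HarrisLanTaylorThorneRMS2016]
* J.-P. Serre, *Abelian ℓ-adic representations and elliptic curves* (1968), Ch. I §2.1, §2.3.
  [SerreAbelianLadic1968]
* J. Arthur, L. Clozel, *Simple algebras, base change, and the advanced theory of the trace
  formula* (1989), Ch. 3, (1.1) (`c(Π_w) = c(π_v)^{f(w|v)}`).
-/

noncomputable section

open scoped MatrixGroups Matrix Polynomial NumberField
open NumberField IsDedekindDomain Field Polynomial Filter
open Literature.NumberTheory.Automorphic

namespace Literature.NumberTheory.GaloisRepresentations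

universe u

/-! ### The inverse dictionary: Frobenius eigenvalues to Satake entries -/

section Dictionary

variable {ℓ : ℕ} [Fact ℓ.Prime]

/-- **The Satake entry attached to an eigenvalue `r ∈ ℚ̄_ℓ` of arithmetic Frobenius**:
`satakeParamOfFrobEigenvalue ι q e r = q^{-(e-1)/2} · ι(r)⁻¹` (`q^{(e-1)/2} = (√q)^{e-1}` as in
`arithFrobPolyOfSatake`), so that `ι⁻¹((q^{(e-1)/2} a)⁻¹) = r` for this `a`.  With `e = n`: from the
eigenvalues of `r_{ℓ,ι}(π)(Frob_v)` to the Satake parameter of `π_v` (Harris–Lan–Taylor–Thorne's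
normalisation); `e = 1`: Buzzard–Gee's `α_j = ι(r_j)⁻¹`.  Junk: `r = 0 ↦ 0`.
Buzzard–Gee 2014, §2.2, Rem. 3.2.5; Harris–Lan–Taylor–Thorne 2016, Thm. A. [folklore] -/
def satakeParamOfFrobEigenvalue (ι : PadicAlgCl ℓ ≃+* ℂ) (q e : ℕ) (r : PadicAlgCl ℓ) : ℂ :=
  ((((Real.sqrt q : ℝ) : ℂ) ^ (e - 1))⁻¹) * (ι r)⁻¹

/-- The half-twist factor `(√q)^{e-1}` is non-zero for `q > 0`. [folklore] -/
theorem sqrt_pow_ne_zero {q : ℕ} (hq : 0 < q) (e : ℕ) :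
    (((Real.sqrt q : ℝ) : ℂ) ^ (e - 1)) ≠ 0 :=
  pow_ne_zero _ (Complex.ofReal_ne_zero.mpr (Real.sqrt_pos.mpr (by exact_mod_cast hq)).ne')

/-- **The dictionary inverts, I**:
`arithFrobPolyOfSatake ι q e (s.map (satakeParamOfFrobEigenvalue ι q e)) = ∏_{r ∈ s} (X - r)`.
[folklore] -/
theorem arithFrobPolyOfSatake_map_satakeParamOfFrobEigenvalue (ι : PadicAlgCl ℓ ≃+* ℂ) {q : ℕ}
    (hq : 0 < q) (e : ℕ) (s : Multiset (PadicAlgCl ℓ)) :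
    arithFrobPolyOfSatake ι q e (s.map (satakeParamOfFrobEigenvalue ι q e)) =
      (s.map fun r ↦ X - C r).prod := by
  rw [arithFrobPolyOfSatake, Multiset.map_map]
  congr 1
  refine Multiset.map_congr rfl fun r _ ↦ ?_
  simp only [Function.comp_apply, satakeParamOfFrobEigenvalue]
  rw [mul_inv_cancel_left₀ (sqrt_pow_ne_zero hq e), inv_inv, RingEquiv.symm_apply_apply]

/-- **The dictionary inverts, II**: the Satake entries attached to the roots of
`arithFrobPolyOfSatake ι q e α` are the entries of `α`
(`roots_arithFrobPolyOfSatake`: the roots are the `ι⁻¹((q^{(e-1)/2} a)⁻¹)`). [folklore] -/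
theorem map_satakeParamOfFrobEigenvalue_roots_arithFrobPolyOfSatake (ι : PadicAlgCl ℓ ≃+* ℂ)
    {q : ℕ} (hq : 0 < q) (e : ℕ) (α : Multiset ℂ) :
    (arithFrobPolyOfSatake ι q e α).roots.map (satakeParamOfFrobEigenvalue ι q e) = α := by
  rw [roots_arithFrobPolyOfSatake, Multiset.map_map]
  conv_rhs => rw [← Multiset.map_id α]
  refine Multiset.map_congr rfl fun a _ ↦ ?_
  simp only [Function.comp_apply, satakeParamOfFrobEigenvalue, id]
  rw [RingEquiv.apply_symm_apply, inv_inv, inv_mul_cancel_left₀ (sqrt_pow_ne_zero hq e)]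

/-- **The Satake-to-Frobenius dictionary is injective** (`q > 0`, any shift `e`; the case
`e = 1` is the accepted `arithFrobPolyOfSatake_one_injective`): it has the left inverse
`P ↦ P.roots.map (satakeParamOfFrobEigenvalue ι q e)`.  Buzzard–Gee 2014, Rem. 3.2.5. [folklore] -/
theorem arithFrobPolyOfSatake_injective (ι : PadicAlgCl ℓ ≃+* ℂ) {q : ℕ} (hq : 0 < q) (e : ℕ) :
    Function.Injective (arithFrobPolyOfSatake ι q e) := by
  intro α β h
  rw [← map_satakeParamOfFrobEigenvalue_roots_arithFrobPolyOfSatake ι hq e α,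
    ← map_satakeParamOfFrobEigenvalue_roots_arithFrobPolyOfSatake ι hq e β, h]

end Dictionary

/-! ### Eigenvalues and Frobenius polynomials of framed representations -/

section Framed

variable {K : Type u} [Field K] [NumberField K] {A : Type*} [CommRing A] [TopologicalSpace A]
  {n : ℕ}

/-- Local copy of the accepted `FramedGaloisRep.HasFrobCharpolyAt.unique`
(`GaloisRepresentations/ResidualPairIntegrality`, landed concurrently; kept `private` here so as
not to import the residual-representation cone): over a number field, `ρ.HasFrobCharpolyAt v P` and
`ρ.HasFrobCharpolyAt v Q` force `P = Q` (a prime above `v` carries an arithmetic Frobenius,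
`primesAbove_nonempty`, `exists_isArithFrobAt_of_mem_primesAbove_holds`).  Serre 1968, Ch. I §2.1.
[cite: SerreAbelianLadic1968, Ch. I §2.1] -/
private theorem hasFrobCharpolyAt_unique {v : HeightOneSpectrum (𝓞 K)} {ρ : FramedGaloisRep K A n}
    {P Q : Polynomial A} (hP : ρ.HasFrobCharpolyAt v P) (hQ : ρ.HasFrobCharpolyAt v Q) : P = Q := by
  obtain ⟨𝔓, h𝔓⟩ := v.primesAbove_nonempty
  obtain ⟨σ, hσ⟩ := HeightOneSpectrum.exists_isArithFrobAt_of_mem_primesAbove_holds h𝔓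
  rw [← hP 𝔓 h𝔓 σ hσ, ← hQ 𝔓 h𝔓 σ hσ]

/-- Local copy of the accepted `FramedGaloisRep.IsUnramifiedAt.hasFrobCharpolyAt_charpoly`
(`ResidualPairIntegrality`; `private` for the same reason): if `ρ : Γ_K →ₜ* GL_n(A)` is unramified
at `v` and `σ` is an arithmetic Frobenius at some `𝔓 ∣ v`, then `ρ.HasFrobCharpolyAt v (charpoly ρ(σ))`
(the accepted `GaloisRep.IsUnramifiedAt.hasFrobCharpolyAt_charpoly` through `ρ.toGaloisRep`,
`isUnramifiedAt_toGaloisRep_iff`, `hasFrobCharpolyAt_toGaloisRep_iff`).  Serre 1968, Ch. I §2.1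
("`P_{v,ρ}` depends only on `v`"). [cite: SerreAbelianLadic1968, Ch. I §2.1] -/
private theorem hasFrobCharpolyAt_charpoly_of_isUnramifiedAt [IsTopologicalRing A]
    {v : HeightOneSpectrum (𝓞 K)} {ρ : FramedGaloisRep K A n} (h : ρ.IsUnramifiedAt v)
    {𝔓 : Ideal (absIntegers (𝓞 K) K)} (h𝔓 : 𝔓 ∈ v.primesAbove) {σ : absoluteGaloisGroup K}
    (hσ : IsArithFrobAt (𝓞 K) σ 𝔓) : ρ.HasFrobCharpolyAt v (FramedRep.charpoly ρ σ) := by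
  have hQ : ρ.HasFrobCharpolyAt v (ρ.toGaloisRep σ).charpoly :=
    (FramedGaloisRep.hasFrobCharpolyAt_toGaloisRep_iff v _ ρ).mp
      (((FramedGaloisRep.isUnramifiedAt_toGaloisRep_iff v ρ).mpr h).hasFrobCharpolyAt_charpoly
        h𝔓 hσ)
  rw [hQ 𝔓 h𝔓 σ hσ]
  exact hQ

/-- Over a field, `0` is not an eigenvalue of `ρ(g) ∈ GL_n`: the constant coefficient of the
characteristic polynomial is `± det ρ(g) ≠ 0` (Mathlib `Matrix.det_eq_sign_charpoly_coeff`,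
`Matrix.isUnits_det_units`). [folklore] -/
theorem FramedRep.zero_not_mem_roots_charpoly {G : Type*} [Group G] [TopologicalSpace G]
    {k : Type*} [Field k] [TopologicalSpace k] (ρ : FramedRep G k n) (g : G) :
    (0 : k) ∉ (FramedRep.charpoly ρ g).roots := by
  intro h0
  have hroot := (mem_roots (Matrix.charpoly_monic _).ne_zero).mp h0
  have hcoeff : (FramedRep.charpoly ρ g).coeff 0 = 0 := by
    rwa [coeff_zero_eq_eval_zero]
  have hdet : ((ρ g : GL (Fin n) k) : Matrix (Fin n) (Fin n) k).det = 0 := by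
    rw [Matrix.det_eq_sign_charpoly_coeff]
    change _ * (FramedRep.charpoly ρ g).coeff 0 = 0
    rw [hcoeff, mul_zero]
  exact (Matrix.isUnits_det_units (ρ g)).ne_zero hdet

/-- Over an algebraically closed field, `charpoly ρ(g) = ∏_r (X - r)` over its roots (the
eigenvalues of `ρ(g)` with multiplicity; Mathlib `prod_multiset_X_sub_C_of_monic_of_roots_card_eq`,
`IsAlgClosed.card_roots_eq_natDegree`). [folklore] -/
theorem FramedRep.prod_X_sub_C_roots_charpoly {G : Type*} [Group G] [TopologicalSpace G]
    {k : Type*} [Field k] [IsAlgClosed k] [TopologicalSpace k] (ρ : FramedRep G k n) (g : G) :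
    ((FramedRep.charpoly ρ g).roots.map fun r ↦ X - C r).prod = FramedRep.charpoly ρ g :=
  prod_multiset_X_sub_C_of_monic_of_roots_card_eq (Matrix.charpoly_monic _)
    IsAlgClosed.card_roots_eq_natDegree

end Framed

/-! ### The Satake family of `ρ` -/

section SatakeFamily

variable {K : Type u} [Field K] [NumberField K] {ℓ : ℕ} [Fact ℓ.Prime] {n : ℕ}

open scoped Classical in
/-- `if h : ∃ a, p a then h.choose else d` only depends on the predicate `p` (used for the
congruence properties of `satakeFamilyOfFramedGaloisRep`). [folklore] -/
theorem dite_exists_choose_congr {τ : Type*} {p q : τ → Prop} (hpq : p = q) (d : τ) :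
    (if h : ∃ a, p a then h.choose else d) = if h : ∃ a, q a then h.choose else d := by
  subst hpq; rfl

open scoped Classical in
/-- **The Satake family of the `ℓ`-adic Galois representation `ρ` (via `ι`, shift `e`).**  For
`ρ : Γ_K →ₜ* GL_n(ℚ̄_ℓ)`, `ι : ℚ̄_ℓ ≃+* ℂ` and a finite place `v` of the number field `K`:
*the* multiset `α` of complex numbers such that every arithmetic Frobenius at `v` has
characteristic polynomial `arithFrobPolyOfSatake ι q_v e α = ∏_{a ∈ α} (X - ι⁻¹((q_v^{(e-1)/2} a)⁻¹))`
on `ρ`, if such an `α` exists — it is then unique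
(`satakeFamilyOfFramedGaloisRep_eq_of_hasFrobCharpolyAt`), has `n` non-zero entries, and exists at
every place where `ρ` is unramified, where it is `{q_v^{-(e-1)/2} ι(r)⁻¹}` over the eigenvalues
`r` of `ρ(Frob_v)` (`IsUnramifiedAt.satakeFamilyOfFramedGaloisRep_eq`) — and the **junk value
`{1, …, 1}` (`n` entries)** otherwise.  Shift `e = n`: the Satake parameters of the unramified
`π_v` with `ρ|_{W_v}^{ss} = ι⁻¹ rec(π_v ⊗ |det|^{(1-n)/2})` (Harris–Lan–Taylor–Thorne's
normalisation, **lang.S27**); `e = 1`: Buzzard–Gee's L-normalisation `α_j = ι(r_j)⁻¹`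
(**lang.S03**, `IsAutomorphicAE`).  Buzzard–Gee 2014, §2.2, Conj. 3.2.1, Rem. 3.2.5;
Harris–Lan–Taylor–Thorne 2016, Thm. A; Taylor, *Galois representations* (2004), §1. [folklore] -/
def satakeFamilyOfFramedGaloisRep (ι : PadicAlgCl ℓ ≃+* ℂ) (e : ℕ)
    (ρ : FramedGaloisRep K (PadicAlgCl ℓ) n) : HeightOneSpectrum (𝓞 K) → Multiset ℂ :=
  fun v ↦
    if h : ∃ α : Multiset ℂ, ρ.HasFrobCharpolyAt v (arithFrobPolyOfSatake ι v.residueCard e α)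
    then h.choose else Multiset.replicate n 1

variable (ι : PadicAlgCl ℓ ≃+* ℂ) (e : ℕ) (ρ : FramedGaloisRep K (PadicAlgCl ℓ) n)

/-- Defining property, positive branch: if some multiset predicts the Frobenius characteristic
polynomial of `ρ` at `v`, so does `satakeFamilyOfFramedGaloisRep ι e ρ v`. [folklore] -/
theorem hasFrobCharpolyAt_satakeFamilyOfFramedGaloisRep_of_exists {v : HeightOneSpectrum (𝓞 K)}
    (h : ∃ α : Multiset ℂ, ρ.HasFrobCharpolyAt v (arithFrobPolyOfSatake ι v.residueCard e α)) :
    ρ.HasFrobCharpolyAt v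
      (arithFrobPolyOfSatake ι v.residueCard e (satakeFamilyOfFramedGaloisRep ι e ρ v)) := by
  simp only [satakeFamilyOfFramedGaloisRep, dif_pos h]
  exact h.choose_spec

/-- Junk branch: if no multiset predicts the Frobenius characteristic polynomial of `ρ` at `v`
(possible only at a ramified place), the value is `{1, …, 1}`. [folklore] -/
theorem satakeFamilyOfFramedGaloisRep_of_not_exists {v : HeightOneSpectrum (𝓞 K)}
    (h : ¬ ∃ α : Multiset ℂ, ρ.HasFrobCharpolyAt v (arithFrobPolyOfSatake ι v.residueCard e α)) :
    satakeFamilyOfFramedGaloisRep ι e ρ v = Multiset.replicate n 1 := by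
  simp only [satakeFamilyOfFramedGaloisRep, dif_neg h]

variable {ι e ρ} in
/-- **Uniqueness.**  A multiset `β` predicting the Frobenius characteristic polynomial of `ρ` at
`v` *is* `satakeFamilyOfFramedGaloisRep ι e ρ v`: the Frobenius polynomial at `v` is unique
(accepted `FramedGaloisRep.HasFrobCharpolyAt.unique`) and the dictionary is injective
(`arithFrobPolyOfSatake_injective`, `q_v > 1`).  Buzzard–Gee 2014, Rem. 3.2.5. [folklore] -/
theorem satakeFamilyOfFramedGaloisRep_eq_of_hasFrobCharpolyAt {v : HeightOneSpectrum (𝓞 K)}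
    {β : Multiset ℂ} (hβ : ρ.HasFrobCharpolyAt v (arithFrobPolyOfSatake ι v.residueCard e β)) :
    satakeFamilyOfFramedGaloisRep ι e ρ v = β :=
  arithFrobPolyOfSatake_injective ι (zero_lt_one.trans v.one_lt_residueCard) e
    (hasFrobCharpolyAt_unique
      (hasFrobCharpolyAt_satakeFamilyOfFramedGaloisRep_of_exists ι e ρ ⟨β, hβ⟩) hβ)

variable {ι e ρ} in
/-- If `α` predicts the Frobenius characteristic polynomial of `ρ` at `v`, then
`arithFrobPolyOfSatake ι q_v e α = charpoly ρ(σ)` for an actual Frobenius element `σ`; so `α` has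
`n` entries, all non-zero (`FramedRep.zero_not_mem_roots_charpoly`). [folklore] -/
theorem card_eq_and_ne_zero_of_hasFrobCharpolyAt {v : HeightOneSpectrum (𝓞 K)} {α : Multiset ℂ}
    (hα : ρ.HasFrobCharpolyAt v (arithFrobPolyOfSatake ι v.residueCard e α)) :
    Multiset.card α = n ∧ ∀ a ∈ α, a ≠ 0 := by
  obtain ⟨𝔓, h𝔓⟩ := v.primesAbove_nonempty
  obtain ⟨σ, hσ⟩ := HeightOneSpectrum.exists_isArithFrobAt_of_mem_primesAbove_holds h𝔓
  have hP : arithFrobPolyOfSatake ι v.residueCard e α = FramedRep.charpoly ρ σ :=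
    (hα 𝔓 h𝔓 σ hσ).symm
  refine ⟨?_, fun a ha ha0 ↦ ?_⟩
  · rw [← natDegree_arithFrobPolyOfSatake ι v.residueCard e α, hP, FramedRep.charpoly,
      Matrix.charpoly_natDegree_eq_dim, Fintype.card_fin]
  · have hr : ι.symm ((((Real.sqrt v.residueCard : ℝ) : ℂ) ^ (e - 1) * a)⁻¹) ∈
        (arithFrobPolyOfSatake ι v.residueCard e α).roots := by
      rw [roots_arithFrobPolyOfSatake]
      exact Multiset.mem_map_of_mem _ ha
    rw [ha0, mul_zero, inv_zero, map_zero, hP] at hr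
    exact FramedRep.zero_not_mem_roots_charpoly ρ σ hr

/-- **The Satake family has `n` entries at every place** (genuine or junk). [folklore] -/
theorem card_satakeFamilyOfFramedGaloisRep (v : HeightOneSpectrum (𝓞 K)) :
    Multiset.card (satakeFamilyOfFramedGaloisRep ι e ρ v) = n := by
  by_cases h : ∃ α : Multiset ℂ, ρ.HasFrobCharpolyAt v (arithFrobPolyOfSatake ι v.residueCard e α)
  · exact (card_eq_and_ne_zero_of_hasFrobCharpolyAt
      (hasFrobCharpolyAt_satakeFamilyOfFramedGaloisRep_of_exists ι e ρ h)).1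
  · rw [satakeFamilyOfFramedGaloisRep_of_not_exists ι e ρ h, Multiset.card_replicate]

/-- **The entries of the Satake family are non-zero at every place** (eigenvalues of an
invertible matrix are non-zero; the junk entries are `1`). [folklore] -/
theorem satakeFamilyOfFramedGaloisRep_ne_zero (v : HeightOneSpectrum (𝓞 K)) :
    ∀ a ∈ satakeFamilyOfFramedGaloisRep ι e ρ v, a ≠ 0 := by
  by_cases h : ∃ α : Multiset ℂ, ρ.HasFrobCharpolyAt v (arithFrobPolyOfSatake ι v.residueCard e α)
  · exact (card_eq_and_ne_zero_of_hasFrobCharpolyAt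
      (hasFrobCharpolyAt_satakeFamilyOfFramedGaloisRep_of_exists ι e ρ h)).2
  · intro a ha
    rw [satakeFamilyOfFramedGaloisRep_of_not_exists ι e ρ h] at ha
    rw [Multiset.eq_of_mem_replicate ha]
    exact one_ne_zero

variable {ρ} in
/-- **Frobenius eigenvalues give a Satake parameter**: if `ρ` is unramified at `v` and `σ` is an
arithmetic Frobenius at a prime `𝔓 ∣ v`, the multiset `{q_v^{-(e-1)/2} ι(r)⁻¹ : r}` over the roots
`r` of `charpoly ρ(σ)` (with multiplicity; over the algebraically closed `ℚ̄_ℓ` they exhaust it,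
`FramedRep.prod_X_sub_C_roots_charpoly`) predicts the Frobenius characteristic polynomial of `ρ`
at `v`.  Buzzard–Gee 2014, §2.2, Rem. 3.2.5. [folklore] -/
theorem FramedGaloisRep.IsUnramifiedAt.hasFrobCharpolyAt_arithFrobPolyOfSatake_roots
    {v : HeightOneSpectrum (𝓞 K)} (hρ : ρ.IsUnramifiedAt v) {𝔓 : Ideal (absIntegers (𝓞 K) K)}
    (h𝔓 : 𝔓 ∈ v.primesAbove) {σ : absoluteGaloisGroup K} (hσ : IsArithFrobAt (𝓞 K) σ 𝔓) :
    ρ.HasFrobCharpolyAt v (arithFrobPolyOfSatake ι v.residueCard e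
      ((FramedRep.charpoly ρ σ).roots.map (satakeParamOfFrobEigenvalue ι v.residueCard e))) := by
  rw [arithFrobPolyOfSatake_map_satakeParamOfFrobEigenvalue ι
      (zero_lt_one.trans v.one_lt_residueCard), FramedRep.prod_X_sub_C_roots_charpoly]
  exact hasFrobCharpolyAt_charpoly_of_isUnramifiedAt hρ h𝔓 hσ

variable {ρ} in
/-- **The Satake family at an unramified place, explicitly**: if `ρ` is unramified at `v` and
`σ` is an arithmetic Frobenius at a prime `𝔓 ∣ v`, then
`satakeFamilyOfFramedGaloisRep ι e ρ v = {q_v^{-(e-1)/2} ι(r)⁻¹ : r}` over the eigenvalues `r` of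
`ρ(σ)` (with multiplicity).  Buzzard–Gee 2014, §2.2, Rem. 3.2.5; Harris–Lan–Taylor–Thorne 2016,
Thm. A (normalisation `e = n`). [folklore] -/
theorem FramedGaloisRep.IsUnramifiedAt.satakeFamilyOfFramedGaloisRep_eq {v : HeightOneSpectrum (𝓞 K)}
    (hρ : ρ.IsUnramifiedAt v) {𝔓 : Ideal (absIntegers (𝓞 K) K)} (h𝔓 : 𝔓 ∈ v.primesAbove)
    {σ : absoluteGaloisGroup K} (hσ : IsArithFrobAt (𝓞 K) σ 𝔓) :
    satakeFamilyOfFramedGaloisRep ι e ρ v =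
      (FramedRep.charpoly ρ σ).roots.map (satakeParamOfFrobEigenvalue ι v.residueCard e) :=
  satakeFamilyOfFramedGaloisRep_eq_of_hasFrobCharpolyAt
    (hρ.hasFrobCharpolyAt_arithFrobPolyOfSatake_roots ι e h𝔓 hσ)

variable {ρ} in
/-- **At an unramified place the Satake family predicts the Frobenius characteristic
polynomial**: if `ρ` is unramified at `v` then every arithmetic Frobenius at every prime above `v`
has characteristic polynomial `arithFrobPolyOfSatake ι q_v e (satakeFamilyOfFramedGaloisRep ι e ρ v)`
on `ρ` — the defining property of "the Satake parameter of `ρ` at `v`".  Buzzard–Gee 2014, §2.2,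
Conj. 3.2.1; Harris–Lan–Taylor–Thorne 2016, Thm. A. [folklore] -/
theorem FramedGaloisRep.IsUnramifiedAt.hasFrobCharpolyAt_satakeFamilyOfFramedGaloisRep
    {v : HeightOneSpectrum (𝓞 K)} (hρ : ρ.IsUnramifiedAt v) :
    ρ.HasFrobCharpolyAt v
      (arithFrobPolyOfSatake ι v.residueCard e (satakeFamilyOfFramedGaloisRep ι e ρ v)) := by
  obtain ⟨𝔓, h𝔓⟩ := v.primesAbove_nonempty
  obtain ⟨σ, hσ⟩ := HeightOneSpectrum.exists_isArithFrobAt_of_mem_primesAbove_holds h𝔓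
  exact hasFrobCharpolyAt_satakeFamilyOfFramedGaloisRep_of_exists ι e ρ
    ⟨_, hρ.hasFrobCharpolyAt_arithFrobPolyOfSatake_roots ι e h𝔓 hσ⟩

variable {ρ} in
/-- **Unramified almost everywhere ⟹ Satake–Frobenius compatible almost everywhere**, in the
shape of the compatibility clauses of **lang.S27** / **lang.S03** with
`α = satakeFamilyOfFramedGaloisRep ι e ρ v`.  Buzzard–Gee 2014, Conj. 3.2.1. [folklore] -/
theorem eventually_hasFrobCharpolyAt_satakeFamilyOfFramedGaloisRep
    (hρ : ∀ᶠ v : HeightOneSpectrum (𝓞 K) in cofinite, ρ.IsUnramifiedAt v) :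
    ∀ᶠ v : HeightOneSpectrum (𝓞 K) in cofinite, ρ.IsUnramifiedAt v ∧
      ρ.HasFrobCharpolyAt v
        (arithFrobPolyOfSatake ι v.residueCard e (satakeFamilyOfFramedGaloisRep ι e ρ v)) :=
  hρ.mono fun _ hv ↦ ⟨hv, hv.hasFrobCharpolyAt_satakeFamilyOfFramedGaloisRep ι e⟩

variable {ι e ρ} in
/-- **Uniqueness up to a finite exceptional set.**  A family `β` predicting the Frobenius
characteristic polynomials of `ρ` at all but finitely many places agrees with
`satakeFamilyOfFramedGaloisRep ι e ρ` at all but finitely many places. [folklore] -/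
theorem eventuallyEq_satakeFamilyOfFramedGaloisRep {β : HeightOneSpectrum (𝓞 K) → Multiset ℂ}
    (hβ : ∀ᶠ v : HeightOneSpectrum (𝓞 K) in cofinite,
      ρ.HasFrobCharpolyAt v (arithFrobPolyOfSatake ι v.residueCard e (β v))) :
    satakeFamilyOfFramedGaloisRep ι e ρ =ᶠ[cofinite] β :=
  hβ.mono fun _ hv ↦ satakeFamilyOfFramedGaloisRep_eq_of_hasFrobCharpolyAt hv

variable {ρ} in
/-- The Satake family only depends on the Frobenius characteristic-polynomial predicates: two
representations with the same `HasFrobCharpolyAt v` at `v` have the same Satake family at `v`.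
[folklore] -/
theorem satakeFamilyOfFramedGaloisRep_congr {ρ' : FramedGaloisRep K (PadicAlgCl ℓ) n}
    {v : HeightOneSpectrum (𝓞 K)}
    (h : ∀ P : Polynomial (PadicAlgCl ℓ), ρ.HasFrobCharpolyAt v P ↔ ρ'.HasFrobCharpolyAt v P) :
    satakeFamilyOfFramedGaloisRep ι e ρ v = satakeFamilyOfFramedGaloisRep ι e ρ' v :=
  dite_exists_choose_congr
    (p := fun α ↦ ρ.HasFrobCharpolyAt v (arithFrobPolyOfSatake ι v.residueCard e α))
    (q := fun α ↦ ρ'.HasFrobCharpolyAt v (arithFrobPolyOfSatake ι v.residueCard e α))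
    (funext fun _ ↦ propext (h _)) _

/-- **Invariance under change of frame**: `ρ` and `P ρ P⁻¹` (`FramedRep.conj`) have the same
Satake family (`FramedGaloisRep.hasFrobCharpolyAt_conj_iff`).  Serre 1968, Ch. I §2.3 (`P_{v,ρ}` is
an invariant of the isomorphism class). [cite: SerreAbelianLadic1968, Ch. I §2.3] -/
theorem satakeFamilyOfFramedGaloisRep_conj (P : GL (Fin n) (PadicAlgCl ℓ)) :
    satakeFamilyOfFramedGaloisRep ι e (FramedRep.conj P ρ) = satakeFamilyOfFramedGaloisRep ι e ρ :=
  funext fun v ↦ satakeFamilyOfFramedGaloisRep_congr ι e fun Q ↦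
    FramedGaloisRep.hasFrobCharpolyAt_conj_iff v P Q ρ

variable {ρ} in
/-- **Invariance under isomorphism**: framed representations whose underlying continuous
representations on `ℚ̄_ℓⁿ` are isomorphic (`ContinuousRep.Equiv`) have the same Satake family
(they are conjugate, `FramedRep.exists_eq_conj_of_equiv`).  Serre 1968, Ch. I §2.3.
[cite: SerreAbelianLadic1968, Ch. I §2.3] -/
theorem satakeFamilyOfFramedGaloisRep_congr_equiv {ρ' : FramedGaloisRep K (PadicAlgCl ℓ) n}
    (h : ContinuousRep.Equiv ρ.toGaloisRep ρ'.toGaloisRep) :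
    satakeFamilyOfFramedGaloisRep ι e ρ = satakeFamilyOfFramedGaloisRep ι e ρ' := by
  obtain ⟨P, rfl⟩ := FramedRep.exists_eq_conj_of_equiv ρ ρ' h
  exact (satakeFamilyOfFramedGaloisRep_conj ι e ρ P).symm

end SatakeFamily

/-! ### Restriction to `Γ_L`: `α_w = α_v^{f(w|v)}` -/

section Restrict

variable {K L : Type} [Field K] [NumberField K] [Field L] [NumberField L] [Algebra K L]
  {ℓ : ℕ} [Fact ℓ.Prime] {n : ℕ}

/-- **The Satake family of a restriction**: if `ρ : Γ_K →ₜ* GL_n(ℚ̄_ℓ)` is unramified at `v` and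
`w` is a place of the finite extension `L ⊇ K` above `v`, then the Satake family of `ρ|_{Γ_L}`
(`FramedGaloisRep.restrictField`) at `w` is `{a^{f(w|v)} : a ∈ α_v}` (`Frob_w ↦ Frob_v^{f(w|v)}`
modulo inertia, `q_w = q_v^{f(w|v)}`: the accepted
`hasFrobCharpolyAt_restrictField_arithFrobPolyOfSatake`, plus uniqueness) — the Galois side of
Arthur–Clozel's base-change relation `c(Π_w) = c(π_v)^{f(w|v)}` (1989, Ch. 3, (1.1)).  Fields in
`Type` as in the accepted lemma. [folklore] -/
theorem satakeFamilyOfFramedGaloisRep_restrictField (ι : PadicAlgCl ℓ ≃+* ℂ) (e : ℕ)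
    (ρ : FramedGaloisRep K (PadicAlgCl ℓ) n) {v : HeightOneSpectrum (𝓞 K)}
    {w : HeightOneSpectrum (𝓞 L)} (hw : w.asIdeal.under (𝓞 K) = v.asIdeal)
    (hρ : ρ.IsUnramifiedAt v) :
    satakeFamilyOfFramedGaloisRep ι e (ρ.restrictField L) w =
      (satakeFamilyOfFramedGaloisRep ι e ρ v).map (· ^ w.asIdeal.inertiaDeg (𝓞 K)) :=
  satakeFamilyOfFramedGaloisRep_eq_of_hasFrobCharpolyAt
    (hasFrobCharpolyAt_restrictField_arithFrobPolyOfSatake ι ρ hw hρ e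
      (hρ.hasFrobCharpolyAt_satakeFamilyOfFramedGaloisRep ι e)).2

/-- **Almost-everywhere form**: if `ρ` is unramified at all but finitely many places of `K`, then
at all but finitely many places `w` of `L` the Satake family of `ρ|_{Γ_L}` at `w` is
`{a^{f(w|v)} : a ∈ α_v}`, `v = w ∩ K` (Mathlib `HeightOneSpectrum.under`; only finitely many `w`
lie over the finitely many bad `v`, `HeightOneSpectrum.tendsto_under_cofinite`). [folklore] -/
theorem eventually_satakeFamilyOfFramedGaloisRep_restrictField (ι : PadicAlgCl ℓ ≃+* ℂ) (e : ℕ)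
    (ρ : FramedGaloisRep K (PadicAlgCl ℓ) n)
    (hρ : ∀ᶠ v : HeightOneSpectrum (𝓞 K) in cofinite, ρ.IsUnramifiedAt v) :
    ∀ᶠ w : HeightOneSpectrum (𝓞 L) in cofinite,
      satakeFamilyOfFramedGaloisRep ι e (ρ.restrictField L) w =
        (satakeFamilyOfFramedGaloisRep ι e ρ (w.under (𝓞 K))).map
          (· ^ w.asIdeal.inertiaDeg (𝓞 K)) :=
  ((HeightOneSpectrum.tendsto_under_cofinite (𝓞 K) (B := 𝓞 L)).eventually hρ).mono
    fun _ hw ↦ satakeFamilyOfFramedGaloisRep_restrictField ι e ρ rfl hw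

end Restrict

/-! ### Automorphic partners: the existential compatibility clause made explicit -/

section Automorphic

open scoped Classical -- `Fintype {w : InfinitePlace K // w.IsReal}` inside `AutomorphyDatum.gl` (H5)

variable {n : ℕ} {K : Type} [Field K] [NumberField K] {hcpt : isCompact_glFiniteIntegralLevel n K}
  {ℓ : ℕ} [Fact ℓ.Prime] (ι : PadicAlgCl ℓ ≃+* ℂ) (e : ℕ)
  (π : AutomorphicRepData (AutomorphyDatum.gl n K hcpt)) (ρ : FramedGaloisRep K (PadicAlgCl ℓ) n)

/-- **Satake–Frobenius compatibility at `v`, explicit form.**  "`π` has some Satake parameter `α`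
at `v`, `ρ` is unramified at `v` and its Frobenii have characteristic polynomial
`arithFrobPolyOfSatake ι q_v e α`" (the per-place clause of **lang.S27** with `e = n`, of
**lang.S03** / `SatakeFrobCompatibleAE` with `e = 1`, and of the route `MaassFreeConverse`) holds
iff `π` has Satake parameter `satakeFamilyOfFramedGaloisRep ι e ρ v` at `v` and `ρ` is unramified
at `v` (uniqueness, and existence at unramified places).  Buzzard–Gee 2014, Conj. 3.2.1.
[folklore] -/
theorem exists_hasSatakeParamAt_and_hasFrobCharpolyAt_iff (v : HeightOneSpectrum (𝓞 K)) :
    (∃ α : Multiset ℂ, π.HasSatakeParamAt v α ∧ ρ.IsUnramifiedAt v ∧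
        ρ.HasFrobCharpolyAt v (arithFrobPolyOfSatake ι v.residueCard e α)) ↔
      π.HasSatakeParamAt v (satakeFamilyOfFramedGaloisRep ι e ρ v) ∧ ρ.IsUnramifiedAt v := by
  constructor
  · rintro ⟨α, hπ, hur, hP⟩
    rw [satakeFamilyOfFramedGaloisRep_eq_of_hasFrobCharpolyAt hP]
    exact ⟨hπ, hur⟩
  · rintro ⟨hπ, hur⟩
    exact ⟨_, hπ, hur, hur.hasFrobCharpolyAt_satakeFamilyOfFramedGaloisRep ι e⟩

/-- **Almost-everywhere compatibility, explicit form**: the existential clause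
`∀ᶠ v, ∃ α, π.HasSatakeParamAt v α ∧ ρ.IsUnramifiedAt v ∧ ρ.HasFrobCharpolyAt v (… e α)` is
equivalent to `∀ᶠ v, π.HasSatakeParamAt v (satakeFamilyOfFramedGaloisRep ι e ρ v) ∧ ρ.IsUnramifiedAt v`.
Buzzard–Gee 2014, Conj. 3.2.1. [folklore] -/
theorem eventually_exists_hasSatakeParamAt_and_hasFrobCharpolyAt_iff :
    (∀ᶠ v : HeightOneSpectrum (𝓞 K) in cofinite, ∃ α : Multiset ℂ, π.HasSatakeParamAt v α ∧
        ρ.IsUnramifiedAt v ∧ ρ.HasFrobCharpolyAt v (arithFrobPolyOfSatake ι v.residueCard e α)) ↔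
      ∀ᶠ v : HeightOneSpectrum (𝓞 K) in cofinite,
        π.HasSatakeParamAt v (satakeFamilyOfFramedGaloisRep ι e ρ v) ∧ ρ.IsUnramifiedAt v := by
  simp only [exists_hasSatakeParamAt_and_hasFrobCharpolyAt_iff]

/-- `ρ` is attached to `π` at almost all places (accepted `SatakeFrobCompatibleAE`, Buzzard–Gee's
L-normalisation) iff at almost all `v`, `π` has Satake parameter
`satakeFamilyOfFramedGaloisRep ι 1 ρ v` and `ρ` is unramified.  Buzzard–Gee 2014, Conj. 3.2.1.
[folklore] -/
theorem satakeFrobCompatibleAE_iff_satakeFamilyOfFramedGaloisRep :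
    SatakeFrobCompatibleAE ι π ρ ↔ ∀ᶠ v : HeightOneSpectrum (𝓞 K) in cofinite,
      π.HasSatakeParamAt v (satakeFamilyOfFramedGaloisRep ι 1 ρ v) ∧ ρ.IsUnramifiedAt v :=
  eventually_exists_hasSatakeParamAt_and_hasFrobCharpolyAt_iff ι 1 π ρ

variable {ι π ρ} in
/-- If `ρ` is compatible with `π` at `v` in Harris–Lan–Taylor–Thorne's normalisation (accepted
`IsGaloisCompatibleAt π ι ρ v`, shift `e = n`) and `π` has Satake parameter `α` at `v`, then
`satakeFamilyOfFramedGaloisRep ι n ρ v = α`: the Satake family of `r_{ℓ,ι}(π)` is the family of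
Satake parameters of `π`.  Harris–Lan–Taylor–Thorne 2016, Thm. A. [folklore] -/
theorem satakeFamilyOfFramedGaloisRep_eq_of_isGaloisCompatibleAt {v : HeightOneSpectrum (𝓞 K)}
    (h : IsGaloisCompatibleAt π ι ρ v) {α : Multiset ℂ} (hα : π.HasSatakeParamAt v α) :
    satakeFamilyOfFramedGaloisRep ι n ρ v = α :=
  satakeFamilyOfFramedGaloisRep_eq_of_hasFrobCharpolyAt (h α hα).2

end Automorphic

end Literature.NumberTheory.GaloisRepresentations
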